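import Summits.ValiantsHypothesis.ValiantsHypothesis.Theses.TwistedDetRank
import Literature.Computability.AlgebraicComplexity.PermanentIrreducible

/-!
# Route TwistedDetRank — item `TdrSuperadditive`

Superadditivity of the twisted-determinantal rank of the permanent, in representation form:
from a representation `per_{a+b} = ∑_{t<r} det (E_t ∘ X)` as a sum of `r` Hadamard-twisted
determinants one obtains representations of `per_a` and `per_b` of lengths `r₁`, `r₂` with
`r₁ + r₂ ≤ r + 1`.

Proof (folklore linear algebra, the substitution / "rank of a tensor product of points" argument):
comparing coefficients of the permutation monomials `∏ᵢ X_{σ i, i}`, a twisted representation of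
`per_n` of length `r` is the same as an identity `sgn σ = ∑_{t<r} ∏ᵢ E_t (σ i) i` on `𝔖ₙ`
(`perPoly_eq_sum_twistedDet_iff`). Restricting to block permutations `σ₁ ⊕ σ₂ ∈ 𝔖_a × 𝔖_b` gives
`sgn σ₁ · sgn σ₂ = ∑_t Û_t(σ₁) V̂_t(σ₂)` with `U_t`, `V_t` the diagonal blocks of `E_t`. Let `ρ` be
the least length of a representation of `sgn_a` (it is `≤ r`: put `σ₂ = 1`). No `ρ - 1` of the
vectors `Û_t ∈ ℂ^{𝔖_a}` span a space containing `sgn_a`, so a linear functional `e` with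
`e (sgn_a) = 1` kills `Û_0, …, Û_{ρ-2}`; applying `e` leaves `sgn_b = ∑_{t ≥ ρ-1} e(Û_t) V̂_t`, a
representation of length `r - ρ + 1` (scalars are absorbed into a column since `b ≥ 1`). The
degenerate cases `a = 0` or `b = 0` are transports along `0 + b = b`, `a + 0 = a`.
-/

-- `Summit.<Summit>.<Problem>` repeats `ValiantsHypothesis` by the tree's layout convention (D-0017).
set_option linter.dupNamespace false

namespace Summit.ValiantsHypothesis.ValiantsHypothesis.Theorems

open Literature.Computability.AlgebraicComplexity MvPolynomial Finset

namespace TwistedDetRankTdrSuperadditive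

variable {n : ℕ}

/-- The permutation monomial `∏ᵢ X_{(σ i, i)}` is the monomial with exponent `permMonomial σ`. -/
theorem prod_X_eq_monomial (σ : Equiv.Perm (Fin n)) :
    ∏ i, (X (σ i, i) : MvPolynomial (Fin n × Fin n) ℂ) = monomial (permMonomial σ) 1 := by
  rw [permMonomial, monomial_sum_one]
  rfl

/-- The Hadamard-twisted generic determinant `det (E ∘ X)` expanded on permutation monomials:
`det (E ∘ X) = ∑_σ sgn σ (∏ᵢ E (σ i) i) · X^{μ_σ}`. -/
theorem twistedDet_eq_sum_monomial (E : Matrix (Fin n) (Fin n) ℂ) :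
    (Matrix.of fun i j => C (E i j) * (X (i, j) : MvPolynomial (Fin n × Fin n) ℂ)).det =
      ∑ σ : Equiv.Perm (Fin n),
        monomial (permMonomial σ) (((Equiv.Perm.sign σ : ℤ) : ℂ) * ∏ i, E (σ i) i) := by
  rw [Matrix.det_apply']
  refine Finset.sum_congr rfl fun σ _ => ?_
  simp only [Matrix.of_apply]
  rw [Finset.prod_mul_distrib, ← map_prod C, prod_X_eq_monomial, C_mul_monomial, mul_one,
    ← C_mul_monomial, map_intCast]

/-- Coefficient extraction on a combination of permutation monomials. -/
theorem coeff_permMonomial_sum_monomial (c : Equiv.Perm (Fin n) → ℂ) (τ : Equiv.Perm (Fin n)) :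
    coeff (permMonomial τ) (∑ σ : Equiv.Perm (Fin n), monomial (permMonomial σ) (c σ)) = c τ := by
  rw [coeff_sum, Finset.sum_eq_single τ]
  · rw [coeff_monomial, if_pos rfl]
  · intro σ _ hσ
    rw [coeff_monomial, if_neg (permMonomial_injective.ne hσ)]
  · intro h
    exact absurd (Finset.mem_univ τ) h

/-- The coefficient of `X^{μ_τ}` in the twisted determinant `det (E ∘ X)` is
`sgn τ · ∏ᵢ E (τ i) i`. -/
theorem coeff_permMonomial_twistedDet (E : Matrix (Fin n) (Fin n) ℂ) (τ : Equiv.Perm (Fin n)) :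
    coeff (permMonomial τ)
        (Matrix.of fun i j => C (E i j) * (X (i, j) : MvPolynomial (Fin n × Fin n) ℂ)).det =
      ((Equiv.Perm.sign τ : ℤ) : ℂ) * ∏ i, E (τ i) i := by
  rw [twistedDet_eq_sum_monomial]
  exact coeff_permMonomial_sum_monomial (fun σ => ((Equiv.Perm.sign σ : ℤ) : ℂ) * ∏ i, E (σ i) i) τ

/-- `sgn σ · sgn σ = 1` in `ℂ`. -/
theorem sign_mul_sign_self (σ : Equiv.Perm (Fin n)) :
    ((Equiv.Perm.sign σ : ℤ) : ℂ) * ((Equiv.Perm.sign σ : ℤ) : ℂ) = 1 := by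
  rcases Int.units_eq_one_or (Equiv.Perm.sign σ) with h | h <;> simp [h]

/-- **Coefficient form of a twisted representation.** `per_n = ∑_t det (E_t ∘ X)` holds iff
`sgn σ = ∑_t ∏ᵢ E_t (σ i) i` for every permutation `σ` (compare coefficients of the permutation
monomials, which are distinct and carry coefficient `1` in the permanent). -/
theorem perPoly_eq_sum_twistedDet_iff {r : ℕ} (E : Fin r → Matrix (Fin n) (Fin n) ℂ) :
    perPoly (Fin n) ℂ =
        ∑ t, (Matrix.of fun i j => C (E t i j) * (X (i, j) : MvPolynomial (Fin n × Fin n) ℂ)).det ↔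
      ∀ σ : Equiv.Perm (Fin n), ((Equiv.Perm.sign σ : ℤ) : ℂ) = ∑ t, ∏ i, E t (σ i) i := by
  constructor
  · intro h σ
    have hc := congrArg (coeff (permMonomial σ)) h
    rw [coeff_permMonomial_perPoly, coeff_sum] at hc
    simp only [coeff_permMonomial_twistedDet] at hc
    rw [← Finset.mul_sum] at hc
    calc ((Equiv.Perm.sign σ : ℤ) : ℂ)
        = ((Equiv.Perm.sign σ : ℤ) : ℂ) * (((Equiv.Perm.sign σ : ℤ) : ℂ) *
            ∑ t, ∏ i, E t (σ i) i) := by rw [← hc, mul_one]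
      _ = ∑ t, ∏ i, E t (σ i) i := by rw [← mul_assoc, sign_mul_sign_self, one_mul]
  · intro h
    rw [perPoly_eq_sum_monomial]
    simp_rw [twistedDet_eq_sum_monomial]
    rw [Finset.sum_comm]
    refine Finset.sum_congr rfl fun σ _ => ?_
    rw [← map_sum, ← Finset.mul_sum, ← h σ, sign_mul_sign_self]

/-- A representation of length `0` is impossible (`sgn 1 = 1 ≠ 0`). -/
theorem not_rep_zero (F : Fin 0 → Matrix (Fin n) (Fin n) ℂ) :
    ¬ ∀ σ : Equiv.Perm (Fin n), ((Equiv.Perm.sign σ : ℤ) : ℂ) = ∑ s, ∏ i, F s (σ i) i := by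
  intro h
  have := h 1
  simp at this

/-- Absorbing scalars: for `n ≥ 1` a combination `∑_s c_s ∏ᵢ F_s (σ i) i` is again a plain sum of
cone elements (scale column `0` of `F_s` by `c_s`). -/
theorem exists_rep_of_smul_rep {k : ℕ} (hn : 1 ≤ n) (f : Equiv.Perm (Fin n) → ℂ) (c : Fin k → ℂ)
    (F : Fin k → Matrix (Fin n) (Fin n) ℂ) (h : ∀ σ, f σ = ∑ s, c s * ∏ i, F s (σ i) i) :
    ∃ F' : Fin k → Matrix (Fin n) (Fin n) ℂ, ∀ σ, f σ = ∑ s, ∏ i, F' s (σ i) i := by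
  refine ⟨fun s i j => (if j = (⟨0, hn⟩ : Fin n) then c s else 1) * F s i j, fun σ => ?_⟩
  rw [h σ]
  refine Finset.sum_congr rfl fun s _ => ?_
  rw [Finset.prod_mul_distrib, Finset.prod_ite_eq']
  simp

/-- **Block restriction.** A coefficient identity `sgn = ∑_t Ê_t` on `𝔖_{a+b}` restricts on block
permutations `σ₁ ⊕ σ₂` to `sgn σ₁ · sgn σ₂ = ∑_t Û_t(σ₁) · V̂_t(σ₂)` with `U_t`, `V_t` the two
diagonal blocks of `E_t`. -/
theorem sign_mul_sign_eq_of_rep {a b r : ℕ} (E : Fin r → Matrix (Fin (a + b)) (Fin (a + b)) ℂ)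
    (h : ∀ σ : Equiv.Perm (Fin (a + b)), ((Equiv.Perm.sign σ : ℤ) : ℂ) = ∑ t, ∏ i, E t (σ i) i)
    (σ₁ : Equiv.Perm (Fin a)) (σ₂ : Equiv.Perm (Fin b)) :
    ((Equiv.Perm.sign σ₁ : ℤ) : ℂ) * ((Equiv.Perm.sign σ₂ : ℤ) : ℂ) =
      ∑ t, (∏ i, E t (Fin.castAdd b (σ₁ i)) (Fin.castAdd b i)) *
        ∏ j, E t (Fin.natAdd a (σ₂ j)) (Fin.natAdd a j) := by
  have key := h (finSumFinEquiv.permCongr (σ₁.sumCongr σ₂))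
  rw [Equiv.Perm.sign_permCongr, Equiv.Perm.sign_sumCongr, Units.val_mul, Int.cast_mul] at key
  rw [key]
  refine Finset.sum_congr rfl fun t _ => ?_
  rw [Fin.prod_univ_add]
  simp

/-- **The functional step.** If `sgn σ₁ · sgn σ₂ = ∑_{t < r} Û_t(σ₁) V̂_t(σ₂)` on `𝔖_a × 𝔖_b`
(`a, b ≥ 1`) and `sgn_a` has no representation of length `m ≤ r`, then `sgn_b` has one of length
`r - m`: `sgn_a ∉ span {Û_0, …, Û_{m-1}}`, so some functional `e` with `e (sgn_a) ≠ 0` kills these,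
and applying `e` in the first factor leaves `sgn_b` as a combination of `V̂_m, …, V̂_{r-1}`. -/
theorem rep_of_not_rep {a b r m : ℕ} (ha : 1 ≤ a) (hb : 1 ≤ b)
    (U : Fin r → Matrix (Fin a) (Fin a) ℂ) (V : Fin r → Matrix (Fin b) (Fin b) ℂ)
    (h : ∀ (σ₁ : Equiv.Perm (Fin a)) (σ₂ : Equiv.Perm (Fin b)),
      ((Equiv.Perm.sign σ₁ : ℤ) : ℂ) * ((Equiv.Perm.sign σ₂ : ℤ) : ℂ) =
        ∑ t, (∏ i, U t (σ₁ i) i) * ∏ j, V t (σ₂ j) j)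
    (hm : m ≤ r)
    (hmin : ¬ ∃ F : Fin m → Matrix (Fin a) (Fin a) ℂ,
      ∀ σ, ((Equiv.Perm.sign σ : ℤ) : ℂ) = ∑ s, ∏ i, F s (σ i) i) :
    ∃ G : Fin (r - m) → Matrix (Fin b) (Fin b) ℂ,
      ∀ σ, ((Equiv.Perm.sign σ : ℤ) : ℂ) = ∑ s, ∏ i, G s (σ i) i := by
  obtain ⟨k, rfl⟩ := Nat.exists_eq_add_of_le hm
  rw [Nat.add_sub_cancel_left]
  -- the vectors of `ℂ^{𝔖_a}` in play
  set sgnv : Equiv.Perm (Fin a) → ℂ := fun σ => ((Equiv.Perm.sign σ : ℤ) : ℂ) with hsgnv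
  set Uhat : Fin (m + k) → Equiv.Perm (Fin a) → ℂ := fun t σ => ∏ i, U t (σ i) i with hUhat
  set W : Submodule ℂ (Equiv.Perm (Fin a) → ℂ) :=
    Submodule.span ℂ (Set.range fun s : Fin m => Uhat (Fin.castAdd k s)) with hW
  have hnot : sgnv ∉ W := by
    intro hmem
    obtain ⟨c, hc⟩ := (Submodule.mem_span_range_iff_exists_fun ℂ).1 hmem
    apply hmin
    refine exists_rep_of_smul_rep ha sgnv c (fun s => U (Fin.castAdd k s)) fun σ => ?_
    have := congrFun hc σ
    simp only [Finset.sum_apply, Pi.smul_apply, smul_eq_mul, hUhat] at this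
    exact this.symm
  obtain ⟨f, hf0, hfW⟩ := Submodule.exists_dual_map_eq_bot_of_notMem hnot inferInstance
  have hfW' : ∀ s : Fin m, f (Uhat (Fin.castAdd k s)) = 0 := fun s => by
    have hv : f (Uhat (Fin.castAdd k s)) ∈ W.map f :=
      Submodule.mem_map_of_mem (Submodule.subset_span ⟨s, rfl⟩)
    rwa [hfW, Submodule.mem_bot] at hv
  have key : ∀ σ₂ : Equiv.Perm (Fin b), ((Equiv.Perm.sign σ₂ : ℤ) : ℂ) =
      ∑ s : Fin k, ((f sgnv)⁻¹ * f (Uhat (Fin.natAdd m s))) *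
        ∏ j, V (Fin.natAdd m s) (σ₂ j) j := by
    intro σ₂
    have hvec : ((Equiv.Perm.sign σ₂ : ℤ) : ℂ) • sgnv = ∑ t, (∏ j, V t (σ₂ j) j) • Uhat t := by
      funext σ₁
      simp only [Pi.smul_apply, Finset.sum_apply, smul_eq_mul, hsgnv, hUhat]
      rw [mul_comm, h σ₁ σ₂]
      exact Finset.sum_congr rfl fun t _ => mul_comm _ _
    have happ := congrArg f hvec
    simp only [map_smul, map_sum, smul_eq_mul] at happ
    rw [Fin.sum_univ_add] at happ
    simp only [hfW', mul_zero, Finset.sum_const_zero, zero_add] at happ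
    have hfs : f sgnv ≠ 0 := hf0
    calc ((Equiv.Perm.sign σ₂ : ℤ) : ℂ)
        = (((Equiv.Perm.sign σ₂ : ℤ) : ℂ) * f sgnv) * (f sgnv)⁻¹ := by field_simp
      _ = ∑ s : Fin k, ((f sgnv)⁻¹ * f (Uhat (Fin.natAdd m s))) *
            ∏ j, V (Fin.natAdd m s) (σ₂ j) j := by
          rw [happ, Finset.sum_mul]
          refine Finset.sum_congr rfl fun s _ => ?_
          simp only [hUhat]
          ring
  exact exists_rep_of_smul_rep hb _ _ _ key

/-- **Superadditivity in coefficient form** (`a, b ≥ 1`): from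
`sgn σ₁ · sgn σ₂ = ∑_{t<r} Û_t(σ₁) V̂_t(σ₂)` one gets representations of `sgn_a`, `sgn_b` of
lengths `r₁ + r₂ ≤ r + 1` (`r₁ = ρ` minimal, `r₂ = r - ρ + 1` by `rep_of_not_rep`). -/
theorem exists_reps {a b r : ℕ} (ha : 1 ≤ a) (hb : 1 ≤ b)
    (U : Fin r → Matrix (Fin a) (Fin a) ℂ) (V : Fin r → Matrix (Fin b) (Fin b) ℂ)
    (h : ∀ (σ₁ : Equiv.Perm (Fin a)) (σ₂ : Equiv.Perm (Fin b)),
      ((Equiv.Perm.sign σ₁ : ℤ) : ℂ) * ((Equiv.Perm.sign σ₂ : ℤ) : ℂ) =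
        ∑ t, (∏ i, U t (σ₁ i) i) * ∏ j, V t (σ₂ j) j) :
    ∃ r₁ r₂ : ℕ, r₁ + r₂ ≤ r + 1 ∧
      (∃ F : Fin r₁ → Matrix (Fin a) (Fin a) ℂ,
        ∀ σ, ((Equiv.Perm.sign σ : ℤ) : ℂ) = ∑ s, ∏ i, F s (σ i) i) ∧
      (∃ G : Fin r₂ → Matrix (Fin b) (Fin b) ℂ,
        ∀ σ, ((Equiv.Perm.sign σ : ℤ) : ℂ) = ∑ s, ∏ i, G s (σ i) i) := by
  classical
  have hr : ∃ F : Fin r → Matrix (Fin a) (Fin a) ℂ,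
      ∀ σ, ((Equiv.Perm.sign σ : ℤ) : ℂ) = ∑ s, ∏ i, F s (σ i) i := by
    refine exists_rep_of_smul_rep ha _ (fun t => ∏ j, V t j j) U fun σ => ?_
    have := h σ 1
    simp only [Equiv.Perm.sign_one, Units.val_one, Int.cast_one, mul_one,
      Equiv.Perm.coe_one, id_eq] at this
    rw [this]
    exact Finset.sum_congr rfl fun t _ => mul_comm _ _
  let P : ℕ → Prop := fun k => ∃ F : Fin k → Matrix (Fin a) (Fin a) ℂ,
    ∀ σ, ((Equiv.Perm.sign σ : ℤ) : ℂ) = ∑ s, ∏ i, F s (σ i) i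
  have hP : ∃ k, P k := ⟨r, hr⟩
  set ρ := Nat.find hP with hρdef
  have hρ : P ρ := Nat.find_spec hP
  have hρr : ρ ≤ r := Nat.find_min' hP hr
  have hρ0 : ρ ≠ 0 := by
    intro h0
    have h' := hρ
    rw [h0] at h'
    obtain ⟨F0, hF0⟩ := h'
    exact not_rep_zero F0 hF0
  have hmin : ¬ P (ρ - 1) := Nat.find_min hP (by omega)
  obtain ⟨G, hG⟩ := rep_of_not_rep ha hb U V h (by omega : ρ - 1 ≤ r) hmin
  exact ⟨ρ, r - (ρ - 1), by omega, hρ, G, hG⟩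

/-- Transport of a twisted representation along an equality of sizes `n = m`. -/
theorem transport {n m r : ℕ} (hnm : n = m) (E : Fin r → Matrix (Fin n) (Fin n) ℂ)
    (hE : perPoly (Fin n) ℂ =
      ∑ t, (Matrix.of fun i j => C (E t i j) * (X (i, j) : MvPolynomial (Fin n × Fin n) ℂ)).det) :
    ∃ E' : Fin r → Matrix (Fin m) (Fin m) ℂ, perPoly (Fin m) ℂ =
      ∑ t, (Matrix.of fun i j => C (E' t i j) * (X (i, j) : MvPolynomial (Fin m × Fin m) ℂ)).det := by
  subst hnm
  exact ⟨E, hE⟩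

/-- The empty permanent is a sum of exactly one (empty) twisted determinant. -/
theorem perPoly_fin_zero_eq_sum_one (E : Fin 1 → Matrix (Fin 0) (Fin 0) ℂ) :
    perPoly (Fin 0) ℂ =
      ∑ t, (Matrix.of fun i j => C (E t i j) * (X (i, j) : MvPolynomial (Fin 0 × Fin 0) ℂ)).det := by
  simp [perPoly, Matrix.permanent_isEmpty, Matrix.det_isEmpty]

end TwistedDetRankTdrSuperadditive

open TwistedDetRankTdrSuperadditive in
/-- **Item `TdrSuperadditive`** (route TwistedDetRank): superadditivity of the twisted-determinantal
rank of the permanent in representation form — a length-`r` representation of `per_{a+b}` as a sum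
of Hadamard-twisted determinants yields representations of `per_a`, `per_b` of lengths `r₁`, `r₂`
with `r₁ + r₂ ≤ r + 1`. -/
theorem tdrSuperadditive_proof :
    Summit.ValiantsHypothesis.ValiantsHypothesis.Theses.TwistedDetRank.TdrSuperadditive := by
  unfold Summit.ValiantsHypothesis.ValiantsHypothesis.Theses.TwistedDetRank.TdrSuperadditive
  intro a b r E hE
  rcases Nat.eq_zero_or_pos a with rfl | ha
  · obtain ⟨E₂, hE₂⟩ := transport (Nat.zero_add b) E hE
    exact ⟨1, r, fun _ => 0, E₂, by omega, perPoly_fin_zero_eq_sum_one _, hE₂⟩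
  rcases Nat.eq_zero_or_pos b with rfl | hb
  · obtain ⟨E₁, hE₁⟩ := transport (Nat.add_zero a) E hE
    exact ⟨r, 1, E₁, fun _ => 0, by omega, hE₁, perPoly_fin_zero_eq_sum_one _⟩
  have hcoef := (perPoly_eq_sum_twistedDet_iff E).1 hE
  have hblock := sign_mul_sign_eq_of_rep E hcoef
  obtain ⟨r₁, r₂, hle, ⟨F, hF⟩, ⟨G, hG⟩⟩ := exists_reps ha hb
    (fun t i j => E t (Fin.castAdd b i) (Fin.castAdd b j))
    (fun t i j => E t (Fin.natAdd a i) (Fin.natAdd a j)) hblock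
  exact ⟨r₁, r₂, F, G, hle, (perPoly_eq_sum_twistedDet_iff F).2 hF,
    (perPoly_eq_sum_twistedDet_iff G).2 hG⟩

end Summit.ValiantsHypothesis.ValiantsHypothesis.Theorems
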